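import Summits.NavierStokesRegularity.FunctionalMining.HsTimeAverageStep
import HarnessLib

/-!
# FunctionalMining — the Foias–Guillopé–Temam time averages of the family `EF.s` at EVERY real order
# `s ≥ 1`: `∫₀ᵀ E_s(u(t))^{1/(2s−1)} dt ≤ K(1+T)` on `T³` (FGT 1981 Thm 3.1 / Chen 1994 (3.5))

Search for candidate a priori estimates; no regularity claim. Cell `pub-nsfunc`, lit seat (gen 16);
third of three files (`HsWeightedDissipation`, `HsTimeAverageStep`, this file) typing the published
a-priori ledger entry of Foias, Guillopé & Temam (Comm. PDE 6 (1981), Thm 3.1; = Thm 2 (3.5) of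
W. Chen, Diff. Integral Eqs. 7 (1994) [held, p. 103]): `∫₀ᵀ |A^{m/2}u|^{2/(2m−1)} dt ≤ K₃(1+T)` for every
integer `m ≥ 1`, `K₃ = K₃(ν, box, f, |u₀|)` (CRITERIA §B rows B3/B4; Gibbon's chessboard column `m = 1`
at every `n`). Here for CLASSICAL zero-mean solutions of the unforced system on `[0, T] × T³`,
`E_s = torusHsEnergy s` (`E_m = ‖∇ᵐu‖₂²`), at every REAL order `s ≥ 1`, printed shape `K(1+T)`:

* `HsTimeAverages.timeAverage_one` — `s = 1`: `∫₀ᵀ E_1 = ∫₀ᵀ‖∇u‖₂² ≤ ‖u(0)‖₂²/(2ν)` (energy equality);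
* `HsTimeAverages.timeAverage_window` — `1 < s < 2` by log-convexity `E_s ≤ E_1^{2−s}E_2^{s−1}` and
  Hölder in time: `∫₀ᵀ E_s^{1/(2s−1)} ≤ (∫₀ᵀ E_1)^{(2−s)/(2s−1)} (∫₀ᵀ E_2^{1/3})^{3(s−1)/(2s−1)}`;
* `HsTimeAverages.timeAverage_succ` — the step `s ↦ s+1` in the shape `K(1+T)` (weighted dissipation
  bound of `HsWeightedDissipation` + `timeAverage_step`);
* `HsTimeAverages.timeAverage_le_of_le_two`, **`HsTimeAverages.timeAverage_le`** — for `s ≥ 1`,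
  `ν > 0`, `M ≥ 0` there is `K = K(s, ν, M) ≥ 0` with `∫₀ᵀ E_s(u(t))^{1/(2s−1)} dt ≤ K(1+T)` along
  every classical zero-mean solution on `[0, T] × T³` with `‖u(0)‖₂² ≤ M` (induction on `⌈s⌉` from the
  window `1 ≤ s ≤ 2`); `timeAverage_le_nat` the integer orders as printed.

Faithfulness / scope: FGT's statement is for weak solutions with a force at integer orders; here
classical solutions, `f = 0`, every real order `s ≥ 1`, the constant existential (through the cell's
production constants `C(s)` and the induction) but with the printed dependence `K(s, ν, ‖u₀‖)` and shape
`K(1+T)`. A priori bounds in the energy class (`E_s^{1/(2s−1)}` scales like `‖∇u‖₂²`); they assert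
neither regularity nor blow-up.

## Mathlib / tree search

Tree (used): `HsTimeAverages.exists_weightedDissipation_le`, `….timeAverage_step`,
`….integral_rpow_mul_rpow_le`, `….continuousOn_hsEnergy` (the two sibling files), `torusHsEnergy_interp`
(`HsProductionBoundRows`), `torusHsEnergy_one`, `Torus.classicalNS_integral_gradNormSq_le`
(`TorusNSFoiasGuillopeTemam`). Searched `timeAverage|2 \* s - 1\)⁻¹` under FunctionalMining: nothing
beyond the rows `s ≤ 3` of the Literature rung files.

## References

* [FoiasGuillopeTemam1981] C. Foias, C. Guillopé, R. Temam, *New a priori estimates for Navier–Stokes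
  equations in dimension 3*, Comm. PDE 6 (1981) 329–359, Thm 3.1.
* [Chen1994GevreyAPriori] W. Chen, *New a priori estimates in Gevrey class of regularity for weak
  solutions of 3D Navier–Stokes equations*, Differential Integral Equations 7 (1994) 101–107, Thm 2
  (3.4)–(3.5) [held: paper:doi-10-57262-die-1369926969, p. 103].
* [Gibbon2019Chessboard] J. D. Gibbon, J. Nonlinear Sci. 29 (2019) 215–228, Thm 1, Table 1 (column
  `m = 1`).
-/

noncomputable section

open MeasureTheory Set Filter Topology Function Real intervalIntegral
open scoped InnerProductSpace RealInnerProductSpace ENNReal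

namespace Summit.NavierStokesRegularity.FunctionalMining

open Literature.Analysis Literature.Analysis.FunctionSpaces Literature.Analysis.FluidPDE
open Literature.Analysis.FunctionSpaces.Torus Literature.Analysis.FluidPDE.Torus

namespace HsTimeAverages

/-! ## 4. The time averages (3.5) at every real order `s ≥ 1` -/

/-- **Base `s = 1`**: `∫₀ᵀ E_1(u(t)) dt = ∫₀ᵀ ‖∇u‖₂² ≤ ‖u(0)‖₂²/(2ν)` (energy equality). [folklore] -/
theorem timeAverage_one {ν T : ℝ} (hν : 0 < ν) (hT : 0 < T)
    {u : ℝ → UnitAddTorus (Fin 3) → EuclideanSpace ℝ (Fin 3)} {p : ℝ → UnitAddTorus (Fin 3) → ℝ}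
    (h : IsClassicalNSSolutionOn (Icc 0 T) ν 0 u p) :
    ∫ t in (0 : ℝ)..T, torusHsEnergy 1 (u t) ^ (2 * (1 : ℝ) - 1)⁻¹ ≤ (∫ x, ‖u 0 x‖ ^ 2) / (2 * ν) := by
  have h1 := Literature.Analysis.FluidPDE.Torus.classicalNS_integral_gradNormSq_le hν hT h
  have h2 : ∫ t in (0 : ℝ)..T, torusHsEnergy 1 (u t) ^ (2 * (1 : ℝ) - 1)⁻¹ =
      ∫ t in (0 : ℝ)..T, Torus.gradNormSq (u t) :=
    intervalIntegral.integral_congr fun t ht => by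
      have ht' : t ∈ Icc 0 T := by rwa [uIcc_of_le hT.le] at ht
      show torusHsEnergy 1 (u t) ^ (2 * (1 : ℝ) - 1)⁻¹ = Torus.gradNormSq (u t)
      rw [show (2 * (1 : ℝ) - 1)⁻¹ = 1 by norm_num, Real.rpow_one,
        torusHsEnergy_one (h.smooth_velocity.isSmooth_slice ht')]
  rw [h2]; exact h1

/-- **The window `1 < s < 2` by log-convexity**: `E_s ≤ E_1^{2−s}E_2^{s−1}`, so
`E_s^{1/(2s−1)} ≤ E_1^{(2−s)/(2s−1)} (E_2^{1/3})^{3(s−1)/(2s−1)}` and Hölder in time with the conjugate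
weights `(2−s)/(2s−1) + 3(s−1)/(2s−1) = 1`:
`∫₀ᵀ E_s^{1/(2s−1)} ≤ (∫₀ᵀ E_1)^{(2−s)/(2s−1)} (∫₀ᵀ E_2^{1/3})^{3(s−1)/(2s−1)}`. [folklore; real-order
interpolation of FoiasGuillopeTemam1981 Thm 3.1 between `m = 1` and `m = 2`] -/
theorem timeAverage_window {s ν T A₁ A₂ : ℝ} (hs1 : 1 < s) (hs2 : s < 2) (hT : 0 < T)
    {u : ℝ → UnitAddTorus (Fin 3) → EuclideanSpace ℝ (Fin 3)} {p : ℝ → UnitAddTorus (Fin 3) → ℝ}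
    (h : IsClassicalNSSolutionOn (Icc 0 T) ν 0 u p)
    (hA₁ : ∫ t in (0 : ℝ)..T, torusHsEnergy 1 (u t) ≤ A₁)
    (hA₂ : ∫ t in (0 : ℝ)..T, torusHsEnergy 2 (u t) ^ (3 : ℝ)⁻¹ ≤ A₂) :
    ∫ t in (0 : ℝ)..T, torusHsEnergy s (u t) ^ (2 * s - 1)⁻¹ ≤
      A₁ ^ ((2 - s) / (2 * s - 1)) * A₂ ^ (3 * (s - 1) / (2 * s - 1)) := by
  have hs0 : 0 ≤ s := by linarith
  have h2s1 : 0 < 2 * s - 1 := by linarith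
  set a : ℝ := (2 - s) / (2 * s - 1) with ha
  set b : ℝ := 3 * (s - 1) / (2 * s - 1) with hb
  have ha0 : 0 < a := by rw [ha]; exact div_pos (by linarith) h2s1
  have hb0 : 0 < b := by rw [hb]; exact div_pos (by linarith) h2s1
  have hab : a + b = 1 := by rw [ha, hb]; field_simp; ring
  set X : ℝ → ℝ := fun t => torusHsEnergy 1 (u t) with hX
  set Y : ℝ → ℝ := fun t => torusHsEnergy 2 (u t) with hY
  set F : ℝ → ℝ := fun t => torusHsEnergy s (u t) with hF
  have hX0 : ∀ t ∈ Icc 0 T, 0 ≤ X t := fun t ht =>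
    torusHsEnergy_nonneg zero_le_one (h.smooth_velocity.isSmooth_slice ht)
  have hY0 : ∀ t ∈ Icc 0 T, 0 ≤ Y t := fun t ht =>
    torusHsEnergy_nonneg (by norm_num) (h.smooth_velocity.isSmooth_slice ht)
  have hF0 : ∀ t ∈ Icc 0 T, 0 ≤ F t := fun t ht =>
    torusHsEnergy_nonneg hs0 (h.smooth_velocity.isSmooth_slice ht)
  set g : ℝ → ℝ := fun t => Y t ^ (3 : ℝ)⁻¹ with hg
  have hg0 : ∀ t ∈ Icc 0 T, 0 ≤ g t := fun t ht => Real.rpow_nonneg (hY0 t ht) _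
  -- pointwise interpolation
  have hpt : ∀ t ∈ Icc 0 T, F t ^ (2 * s - 1)⁻¹ ≤ X t ^ a * g t ^ b := by
    intro t ht
    have hut : IsSmooth (u t) := h.smooth_velocity.isSmooth_slice ht
    have iF : F t ≤ X t ^ (2 - s) * Y t ^ (s - 1) :=
      torusHsEnergy_interp (s₀ := 1) (s₁ := 2) (θ := s - 1) zero_le_one (by norm_num) (by linarith)
        (by linarith) (by ring) (by ring) hut
    have h1 : F t ^ (2 * s - 1)⁻¹ ≤ (X t ^ (2 - s) * Y t ^ (s - 1)) ^ (2 * s - 1)⁻¹ :=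
      Real.rpow_le_rpow (hF0 t ht) iF (inv_nonneg.2 h2s1.le)
    have h2 : (X t ^ (2 - s) * Y t ^ (s - 1)) ^ (2 * s - 1)⁻¹ = X t ^ a * g t ^ b := by
      show _ = X t ^ a * (Y t ^ (3 : ℝ)⁻¹) ^ b
      have e1 : (2 - s) * (2 * s - 1)⁻¹ = a := by rw [ha, div_eq_mul_inv]
      have e2 : (s - 1) * (2 * s - 1)⁻¹ = 3⁻¹ * b := by rw [hb]; field_simp
      rw [Real.mul_rpow (Real.rpow_nonneg (hX0 t ht) _) (Real.rpow_nonneg (hY0 t ht) _),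
        ← Real.rpow_mul (hX0 t ht), ← Real.rpow_mul (hY0 t ht), e1, e2, Real.rpow_mul (hY0 t ht)]
    exact h1.trans_eq h2
  -- continuity
  have hXc : ContinuousOn X (Icc 0 T) := continuousOn_hsEnergy zero_le_one hT h
  have hYc : ContinuousOn Y (Icc 0 T) := continuousOn_hsEnergy (by norm_num) hT h
  have hFc : ContinuousOn F (Icc 0 T) := continuousOn_hsEnergy hs0 hT h
  have hgc : ContinuousOn g (Icc 0 T) := hYc.rpow_const fun t _ => Or.inr (by norm_num)
  have hFσc : ContinuousOn (fun t => F t ^ (2 * s - 1)⁻¹) (Icc 0 T) :=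
    hFc.rpow_const fun t _ => Or.inr (inv_nonneg.2 h2s1.le)
  have hXgc : ContinuousOn (fun t => X t ^ a * g t ^ b) (Icc 0 T) :=
    (hXc.rpow_const fun t _ => Or.inr ha0.le).mul (hgc.rpow_const fun t _ => Or.inr hb0.le)
  have hmono : ∫ t in (0 : ℝ)..T, F t ^ (2 * s - 1)⁻¹ ≤ ∫ t in (0 : ℝ)..T, X t ^ a * g t ^ b :=
    intervalIntegral.integral_mono_on hT.le (hFσc.mono (by rw [uIcc_of_le hT.le])).intervalIntegrable
      (hXgc.mono (by rw [uIcc_of_le hT.le])).intervalIntegrable fun t ht => hpt t ht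
  have hH := integral_rpow_mul_rpow_le hT ha0 hb0 hab hXc hgc hX0 hg0
  have hXi0 : 0 ≤ ∫ t in (0 : ℝ)..T, X t := intervalIntegral.integral_nonneg hT.le fun t ht => hX0 t ht
  have hgi0 : 0 ≤ ∫ t in (0 : ℝ)..T, g t := intervalIntegral.integral_nonneg hT.le fun t ht => hg0 t ht
  refine hmono.trans (hH.trans ?_)
  exact mul_le_mul (Real.rpow_le_rpow hXi0 hA₁ ha0.le) (Real.rpow_le_rpow hgi0 hA₂ hb0.le)
    (Real.rpow_nonneg hgi0 _) (Real.rpow_nonneg (hXi0.trans hA₁) _)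

/-- **The step `s ↦ s + 1` in the printed shape `K(1+T)`**: if `∫₀ᵀ E_s^{1/(2s−1)} ≤ K(1+T)` along
every classical zero-mean solution with `‖u(0)‖₂² ≤ M` (`s ≥ 1`, `ν > 0` fixed), then
`∫₀ᵀ E_{s+1}^{1/(2s+1)} ≤ K'(1+T)` with `K' = (W/ν)^{1/(2s+1)}(1+K)^{2s/(2s+1)}`,
`W = (2s−1) + K_d ν^{−(2s+1)/(2s−1)} M/(2ν)`, `K_d` the constant of `exists_weightedDissipation_le`.
[cite: FoiasGuillopeTemam1981, Thm 3.1 (induction step)] (real order, classical solutions; ours) -/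
theorem timeAverage_succ {s ν M : ℝ} (hs : 1 ≤ s) (hν : 0 < ν) (hM : 0 ≤ M)
    (hK : ∃ K : ℝ, 0 ≤ K ∧ ∀ {T : ℝ}, 0 < T →
      ∀ {u : ℝ → UnitAddTorus (Fin 3) → EuclideanSpace ℝ (Fin 3)} {p : ℝ → UnitAddTorus (Fin 3) → ℝ},
      IsClassicalNSSolutionOn (Icc 0 T) ν 0 u p → (∀ t ∈ Icc 0 T, HasZeroMean (u t)) →
        ∫ x, ‖u 0 x‖ ^ 2 ≤ M →
          ∫ t in (0 : ℝ)..T, torusHsEnergy s (u t) ^ (2 * s - 1)⁻¹ ≤ K * (1 + T)) :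
    ∃ K' : ℝ, 0 ≤ K' ∧ ∀ {T : ℝ}, 0 < T →
      ∀ {u : ℝ → UnitAddTorus (Fin 3) → EuclideanSpace ℝ (Fin 3)} {p : ℝ → UnitAddTorus (Fin 3) → ℝ},
      IsClassicalNSSolutionOn (Icc 0 T) ν 0 u p → (∀ t ∈ Icc 0 T, HasZeroMean (u t)) →
        ∫ x, ‖u 0 x‖ ^ 2 ≤ M →
          ∫ t in (0 : ℝ)..T, torusHsEnergy (s + 1) (u t) ^ (2 * (s + 1) - 1)⁻¹ ≤ K' * (1 + T) := by
  have hs' : 1 / 2 < s := by linarith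
  have h2s1' : 0 < 2 * s + 1 := by linarith
  obtain ⟨Kd, hKd0, hKd⟩ := exists_weightedDissipation_le hs'
  obtain ⟨K, hK0, hK⟩ := hK
  set W : ℝ := (2 * s - 1) + Kd * ν ^ (-((2 * s + 1) / (2 * s - 1))) * (M / (2 * ν)) with hW
  have hνγ : 0 ≤ Kd * ν ^ (-((2 * s + 1) / (2 * s - 1))) := mul_nonneg hKd0 (Real.rpow_nonneg hν.le _)
  have hW0 : 0 ≤ W := by
    rw [hW]
    exact add_nonneg (by linarith) (mul_nonneg hνγ (div_nonneg hM (by linarith)))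
  set a : ℝ := (2 * s + 1)⁻¹ with ha
  set b : ℝ := 2 * s / (2 * s + 1) with hb
  have ha0 : 0 < a := by rw [ha]; positivity
  have hb0 : 0 < b := by rw [hb]; positivity
  have hb1 : b ≤ 1 := by rw [hb, div_le_one h2s1']; linarith
  refine ⟨(W / ν) ^ a * (1 + K) ^ b, mul_nonneg (Real.rpow_nonneg (div_nonneg hW0 hν.le) _)
    (Real.rpow_nonneg (by linarith) _), fun {T} hT u p h hmean hu0 => ?_⟩
  -- the two inputs along this solution
  have hWu : ν * ∫ t in (0 : ℝ)..T, torusHsEnergy (s + 1) (u t) /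
      (1 + torusHsEnergy s (u t)) ^ (1 + (2 * s - 1)⁻¹) ≤ W := by
    have h1 := hKd hν hT h hmean
    have h2 : Kd * ν ^ (-((2 * s + 1) / (2 * s - 1))) * ((∫ x, ‖u 0 x‖ ^ 2) / (2 * ν)) ≤
        Kd * ν ^ (-((2 * s + 1) / (2 * s - 1))) * (M / (2 * ν)) :=
      mul_le_mul_of_nonneg_left (div_le_div_of_nonneg_right hu0 (by linarith)) hνγ
    rw [hW]; linarith
  have hAu := hK hT h hmean hu0
  have hstep := timeAverage_step hs hν hT h hWu hAu
  rw [show 2 * (s + 1) - 1 = 2 * s + 1 by ring]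
  refine hstep.trans ?_
  -- `(T + K(1+T))^b ≤ ((1+K)(1+T))^b = (1+K)^b (1+T)^b ≤ (1+K)^b (1+T)`
  have h1T : 1 ≤ 1 + T := by linarith
  have hTK : T + K * (1 + T) ≤ (1 + K) * (1 + T) := by nlinarith
  have hTK0 : 0 ≤ T + K * (1 + T) := by positivity
  have h3 : (T + K * (1 + T)) ^ b ≤ (1 + K) ^ b * (1 + T) := by
    calc (T + K * (1 + T)) ^ b ≤ ((1 + K) * (1 + T)) ^ b := Real.rpow_le_rpow hTK0 hTK hb0.le
      _ = (1 + K) ^ b * (1 + T) ^ b := Real.mul_rpow (by linarith) (by linarith)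
      _ ≤ (1 + K) ^ b * (1 + T) ^ (1 : ℝ) :=
          mul_le_mul_of_nonneg_left (Real.rpow_le_rpow_of_exponent_le h1T hb1) (Real.rpow_nonneg (by linarith) _)
      _ = (1 + K) ^ b * (1 + T) := by rw [Real.rpow_one]
  have h4 : 0 ≤ (W / ν) ^ a := Real.rpow_nonneg (div_nonneg hW0 hν.le) _
  calc (W / ν) ^ a * (T + K * (1 + T)) ^ b ≤ (W / ν) ^ a * ((1 + K) ^ b * (1 + T)) :=
        mul_le_mul_of_nonneg_left h3 h4
    _ = (W / ν) ^ a * (1 + K) ^ b * (1 + T) := by ring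

/-- **The window `1 ≤ s ≤ 2`** of the time averages in the shape `K(1+T)`: `s = 1` is the energy
equality (`K = M/(2ν)`), `s = 2` one step above it, and `1 < s < 2` by `timeAverage_window`.
[cite: FoiasGuillopeTemam1981, Thm 3.1 (m = 1, 2)] (real order, classical solutions; ours) -/
theorem timeAverage_le_of_le_two {s ν M : ℝ} (hs1 : 1 ≤ s) (hs2 : s ≤ 2) (hν : 0 < ν) (hM : 0 ≤ M) :
    ∃ K : ℝ, 0 ≤ K ∧ ∀ {T : ℝ}, 0 < T →
      ∀ {u : ℝ → UnitAddTorus (Fin 3) → EuclideanSpace ℝ (Fin 3)} {p : ℝ → UnitAddTorus (Fin 3) → ℝ},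
      IsClassicalNSSolutionOn (Icc 0 T) ν 0 u p → (∀ t ∈ Icc 0 T, HasZeroMean (u t)) →
        ∫ x, ‖u 0 x‖ ^ 2 ≤ M →
          ∫ t in (0 : ℝ)..T, torusHsEnergy s (u t) ^ (2 * s - 1)⁻¹ ≤ K * (1 + T) := by
  -- `s = 1`
  have hone : ∃ K : ℝ, 0 ≤ K ∧ ∀ {T : ℝ}, 0 < T →
      ∀ {u : ℝ → UnitAddTorus (Fin 3) → EuclideanSpace ℝ (Fin 3)} {p : ℝ → UnitAddTorus (Fin 3) → ℝ},
      IsClassicalNSSolutionOn (Icc 0 T) ν 0 u p → (∀ t ∈ Icc 0 T, HasZeroMean (u t)) →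
        ∫ x, ‖u 0 x‖ ^ 2 ≤ M →
          ∫ t in (0 : ℝ)..T, torusHsEnergy 1 (u t) ^ (2 * (1 : ℝ) - 1)⁻¹ ≤ K * (1 + T) := by
    refine ⟨M / (2 * ν), div_nonneg hM (by linarith), fun {T} hT u p h _ hu0 => ?_⟩
    have h1 := timeAverage_one hν hT h
    have h2 : (∫ x, ‖u 0 x‖ ^ 2) / (2 * ν) ≤ M / (2 * ν) := div_le_div_of_nonneg_right hu0 (by linarith)
    have h3 : M / (2 * ν) ≤ M / (2 * ν) * (1 + T) :=
      le_mul_of_one_le_right (div_nonneg hM (by linarith)) (by linarith)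
    linarith
  -- `s = 2`
  have htwo : ∃ K : ℝ, 0 ≤ K ∧ ∀ {T : ℝ}, 0 < T →
      ∀ {u : ℝ → UnitAddTorus (Fin 3) → EuclideanSpace ℝ (Fin 3)} {p : ℝ → UnitAddTorus (Fin 3) → ℝ},
      IsClassicalNSSolutionOn (Icc 0 T) ν 0 u p → (∀ t ∈ Icc 0 T, HasZeroMean (u t)) →
        ∫ x, ‖u 0 x‖ ^ 2 ≤ M →
          ∫ t in (0 : ℝ)..T, torusHsEnergy 2 (u t) ^ (2 * (2 : ℝ) - 1)⁻¹ ≤ K * (1 + T) := by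
    have h := timeAverage_succ (s := 1) le_rfl hν hM hone
    simp only [show (1 : ℝ) + 1 = 2 by norm_num] at h
    exact h
  rcases eq_or_lt_of_le hs1 with h1 | h1
  · subst h1; exact hone
  rcases eq_or_lt_of_le hs2 with h2 | h2
  · subst h2; exact htwo
  -- `1 < s < 2`
  obtain ⟨K₁, hK₁0, hK₁⟩ := hone
  obtain ⟨K₂, hK₂0, hK₂⟩ := htwo
  have h2s1 : 0 < 2 * s - 1 := by linarith
  set a : ℝ := (2 - s) / (2 * s - 1) with ha
  set b : ℝ := 3 * (s - 1) / (2 * s - 1) with hb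
  have hab : a + b = 1 := by rw [ha, hb]; field_simp; ring
  refine ⟨K₁ ^ a * K₂ ^ b, mul_nonneg (Real.rpow_nonneg hK₁0 _) (Real.rpow_nonneg hK₂0 _),
    fun {T} hT u p h hmean hu0 => ?_⟩
  have hA₁ : ∫ t in (0 : ℝ)..T, torusHsEnergy 1 (u t) ≤ K₁ * (1 + T) := by
    have := hK₁ hT h hmean hu0
    simp_rw [show (2 * (1 : ℝ) - 1)⁻¹ = 1 by norm_num, Real.rpow_one] at this
    exact this
  have hA₂ : ∫ t in (0 : ℝ)..T, torusHsEnergy 2 (u t) ^ (3 : ℝ)⁻¹ ≤ K₂ * (1 + T) := by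
    have := hK₂ hT h hmean hu0
    simp_rw [show (2 * (2 : ℝ) - 1)⁻¹ = (3 : ℝ)⁻¹ by norm_num] at this
    exact this
  have hw := timeAverage_window h1 h2 hT h hA₁ hA₂
  refine hw.trans_eq ?_
  have h1T : 0 ≤ 1 + T := by linarith
  rw [Real.mul_rpow hK₁0 h1T, Real.mul_rpow hK₂0 h1T]
  have hT1 : (1 + T) ^ a * (1 + T) ^ b = 1 + T := by
    rw [← Real.rpow_add' h1T (by rw [hab]; exact one_ne_zero), hab, Real.rpow_one]
  calc K₁ ^ a * (1 + T) ^ a * (K₂ ^ b * (1 + T) ^ b)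
      = K₁ ^ a * K₂ ^ b * ((1 + T) ^ a * (1 + T) ^ b) := by ring
    _ = K₁ ^ a * K₂ ^ b * (1 + T) := by rw [hT1]

/-- **Foias–Guillopé–Temam time averages at EVERY real order `s ≥ 1` (Thm 3.1 / Chen 1994 (3.5),
classical solutions on `T³`, printed shape).** For `s ≥ 1`, `ν > 0` and `M ≥ 0` there is
`K = K(s, ν, M) ≥ 0` such that along every classical zero-mean solution of the unforced Navier–Stokes
equations on `[0, T] × T³`, `T > 0`, with `‖u(0)‖₂² ≤ M`,
`∫₀ᵀ E_s(u(t))^{1/(2s−1)} dt = ∫₀ᵀ ‖u(t)‖_{Ḣˢ}^{2/(2s−1)} dt ≤ K (1 + T)`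
(at integer `s = m`: `∫₀ᵀ ‖∇ᵐu‖₂^{2/(2m−1)} ≤ K(1+T)`, Gibbon's chessboard column `m = 1` at every `n`;
`s = 1, 2, 3` are the tree's rungs of `TorusNSFoiasGuillopeTemam(H3)` up to constants). Induction on
`⌈s⌉` from the window `1 ≤ s ≤ 2` by `timeAverage_succ`. A priori bound in the energy class; no
regularity claim. [cite: FoiasGuillopeTemam1981, Thm 3.1] [cite: Chen1994GevreyAPriori, Thm 2 (3.5)]
(real order, classical solutions; proof route ours) -/
theorem timeAverage_le {s ν M : ℝ} (hs : 1 ≤ s) (hν : 0 < ν) (hM : 0 ≤ M) :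
    ∃ K : ℝ, 0 ≤ K ∧ ∀ {T : ℝ}, 0 < T →
      ∀ {u : ℝ → UnitAddTorus (Fin 3) → EuclideanSpace ℝ (Fin 3)} {p : ℝ → UnitAddTorus (Fin 3) → ℝ},
      IsClassicalNSSolutionOn (Icc 0 T) ν 0 u p → (∀ t ∈ Icc 0 T, HasZeroMean (u t)) →
        ∫ x, ‖u 0 x‖ ^ 2 ≤ M →
          ∫ t in (0 : ℝ)..T, torusHsEnergy s (u t) ^ (2 * s - 1)⁻¹ ≤ K * (1 + T) := by
  -- strong form: every `s ∈ [1, n + 2]`, by induction on `n`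
  have main : ∀ n : ℕ, ∀ s : ℝ, 1 ≤ s → s ≤ n + 2 →
      ∃ K : ℝ, 0 ≤ K ∧ ∀ {T : ℝ}, 0 < T →
        ∀ {u : ℝ → UnitAddTorus (Fin 3) → EuclideanSpace ℝ (Fin 3)} {p : ℝ → UnitAddTorus (Fin 3) → ℝ},
        IsClassicalNSSolutionOn (Icc 0 T) ν 0 u p → (∀ t ∈ Icc 0 T, HasZeroMean (u t)) →
          ∫ x, ‖u 0 x‖ ^ 2 ≤ M →
            ∫ t in (0 : ℝ)..T, torusHsEnergy s (u t) ^ (2 * s - 1)⁻¹ ≤ K * (1 + T) := by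
    intro n
    induction n with
    | zero =>
      intro s hs1 hs2
      exact timeAverage_le_of_le_two hs1 (by simpa using hs2) hν hM
    | succ n ih =>
      intro s hs1 hs2
      by_cases hsn : s ≤ n + 2
      · exact ih s hs1 hsn
      · rw [not_le] at hsn
        have hs1' : 1 ≤ s - 1 := by
          have : (0 : ℝ) ≤ n := Nat.cast_nonneg n
          linarith
        have hs2' : s - 1 ≤ n + 2 := by push_cast at hs2; linarith
        have h := timeAverage_succ hs1' hν hM (ih (s - 1) hs1' hs2')
        simp only [sub_add_cancel] at h
        exact h
  exact main ⌈s⌉₊ s hs ((Nat.le_ceil s).trans (by linarith))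

/-- **Integer orders (the printed statement)**: for every `m : ℕ`, `m ≥ 1`, `ν > 0`, `M ≥ 0` there is
`K ≥ 0` with `∫₀ᵀ (‖∇ᵐu(t)‖₂²)^{1/(2m−1)} dt ≤ K(1+T)` (`E_m = ‖∇ᵐu‖₂²`: `E_1 = ‖∇u‖₂²`,
`E_2 = ‖Δu‖₂²`) along every classical zero-mean solution on `[0, T] × T³` with `‖u(0)‖₂² ≤ M`.
[cite: FoiasGuillopeTemam1981, Thm 3.1] [cite: Chen1994GevreyAPriori, Thm 2 (3.5)] (classical solutions; proof route ours) -/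
theorem timeAverage_le_nat {m : ℕ} (hm : 1 ≤ m) {ν M : ℝ} (hν : 0 < ν) (hM : 0 ≤ M) :
    ∃ K : ℝ, 0 ≤ K ∧ ∀ {T : ℝ}, 0 < T →
      ∀ {u : ℝ → UnitAddTorus (Fin 3) → EuclideanSpace ℝ (Fin 3)} {p : ℝ → UnitAddTorus (Fin 3) → ℝ},
      IsClassicalNSSolutionOn (Icc 0 T) ν 0 u p → (∀ t ∈ Icc 0 T, HasZeroMean (u t)) →
        ∫ x, ‖u 0 x‖ ^ 2 ≤ M →
          ∫ t in (0 : ℝ)..T, torusHsEnergy (m : ℝ) (u t) ^ (2 * (m : ℝ) - 1)⁻¹ ≤ K * (1 + T) :=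
  timeAverage_le (by exact_mod_cast hm) hν hM

end HsTimeAverages

end Summit.NavierStokesRegularity.FunctionalMining
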